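import Summits.Langlands.Langlands.Theorems.FrobeniusUnitCarvingKernel
import Summits.Langlands.Langlands.Theorems.FrobeniusUnitCarvingRankOne
import Summits.Langlands.Langlands.Theses.FrobeniusUnitCarving
import HarnessLib

/-!
# `FrobeniusUnitCarvingIntegrality` — lens-6 (barrier-complement carving), decomp-langlands g36: the crux FU is
ONE-SIDED INTEGRALITY modulo class-field theory (kernel helper for stmt-Langlands-27434; no definitions)

Crux FU = `Summit.Langlands.Langlands.Theses.FrobeniusUnitCarving.FrobeniusUnits` (stmt-Langlands-27434, deciding crux of the OPEN
route `route-Langlands-FrobeniusUnitCarving`, slot 6): every irreducible geometric `ρ : Γ_K → GL_n(ℚ̄_ℓ)` has, at almost every place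
`v`, Frobenius roots `β` all of whose avatars `ι'⁻¹(ι β) ∈ ℚ̄_{ℓ'}` (`v ∤ ℓ'`) are `ℓ'`-adic UNITS.

This helper records, sorry-free and BY NAME on the route decl, the exact factorisation of FU into

* INT — one-sided `λ`-INTEGRALITY of the avatars, `‖ι'⁻¹(ι β)‖ ≤ 1` (for algebraic `ι β` this says: every conjugate of `ι β` is
  integral at every prime not above `p_v`, i.e. `ι β ∈ ℤ̄[1/p_v]`); and
* DET — the CONSTANT COEFFICIENT `P(0) = (−1)ⁿ det ρ(Frob_v)` of the Frobenius polynomial has unit avatars, `‖ι'⁻¹(ι P(0))‖ = 1`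
  (a statement about the rank-one de Rham character `det ρ` only: class field theory + Tate, [SerreAbelianLadic1968] Ch. III §2.3, [Weil1956];
  in the tree it is the registered `stub_rankOne` of `Cruxes/FrobeniusUnits/Lines/birth.lean` read on `det ρ`, closed modulo the
  named fact `FramedGaloisRep.exists_heckeCharacter_of_isDeRhamFramed` by `FrobeniusUnitCarvingRankOne.rankOne_of_namedFact`):

`frobeniusUnits_iff_integrality_and_determinantUnits : FU ↔ INT ∧ DET` (both directions in kernel; the interesting one,
`frobeniusUnits_of_integrality_of_determinantUnits : INT → DET → FU`, is the ultrametric pigeonhole «`n` numbers of norm `≤ 1` whose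
product has norm `1` all have norm `1`», run on the roots of the MONIC SPLIT polynomial `P = charpoly ρ(σ)` for an arithmetic Frobenius
`σ` at `v`, `P(0) = (−1)^{deg P} ∏ roots`).  Consequences recorded: `integrality_of_langlands` / `determinantUnits_of_langlands`
(both pieces S-implied, through the landed `fu_of_langlands`), and `frobeniusAlgebraicity_of_integrality : INT → FA` (g32's crux
`Theorems.FrobeniusAlgebraicityCarving.FrobeniusAlgebraicity` already follows from one-sided integrality at one prime `ℓ' ∈ {2,3}`,
Steinitz — tree `LArithmeticOfAutToGal.isAlgebraic_of_forall_norm_symm_le_one`).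

READING (the certificate this file supports, `HOME/decomp-langlands-lens-6/g36/UnitResidualLedger36.md`): beyond class field theory the
whole content of FU is INTEGRALITY, not unit-ness — to close FU on any sector a hand needs only a source of `λ`-integrality of the
Frobenius roots (an integral structure carrying the Hecke/Frobenius action at `ℓ'`), plus DET.  No Galois-side engine producing such
integrality for a lone `ℓ`-adic `ρ` without an `ℓ'`-adic avatar is known (the census), so INT is an EDGE of the crux, not a new piece.

§5 types the PRINT status of DET: `determinantUnits_of_namedFact_of_detDeRham` derives DET from the named Hecke-dictionary fact
`FramedGaloisRep.exists_heckeCharacter_of_isDeRhamFramed` (Serre III §2.3 / Patrikis 2019 2.2.1) and ONE further print hypothesis `hdet`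
«ρ de Rham above ℓ ⇒ det ρ de Rham above ℓ» (Fontaine Exp. III Prop. 1.5.2 — in the tree only for rank-one twists, `IsDeRhamFramed.twist_det`),
through the landed `FrobeniusUnitCarvingRankOne.hasUnitFrobenius_rankOne_of_namedFact` applied to `det ρ` framed in `GL₁` and the identity
`det ρ(τ) = (−1)ⁿ P(0)` for every Frobenius `τ` at `v` (`hasFrobCharpolyAt_detFramed`, no unramifiedness needed); PUNCHLINE
`frobeniusUnits_iff_integrality_of_namedFact_of_detDeRham : named → hdet → (FU ↔ INT)` — modulo class field theory FU is one-sided integrality.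

All statements are over accepted declarations; hypotheses are spelled out (no `def`), so the file is a plain `--supports` helper.

## References
* [SerreAbelianLadic1968] J.-P. Serre, *Abelian ℓ-adic representations and elliptic curves* (1968), Ch. I §2.3 (Frobenius polynomials of
  rational / integral ℓ-adic representations), Ch. III §2.3 Thm. 2 (locally algebraic abelian ⇒ Hecke) — the DET piece.
* [Weil1956] A. Weil, *On a certain type of characters of the idèle-class group of an algebraic number-field* (1956) (values of type-`A₀`
  characters are algebraic and generate ideals supported above `p_v`) — the DET piece.
* [Deligne1980] P. Deligne, *La conjecture de Weil II*, Publ. IHÉS 52 (1980) (integrality and weights of Frobenius eigenvalues of compatible /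
  pure systems — the shape of FU; in the tree: `FrobeniusUnitCarving.hasUnitFrobenius_of_compatibleFamily`).
* [BuzzardGeeLMS2014] K. Buzzard, T. Gee, *The conjectural connections between automorphic representations and Galois representations*,
  LMS LNS 414 (2014), §3 (what reciprocity predicts for Frobenius eigenvalues of L-algebraic `π`).
-/

set_option linter.dupNamespace false

namespace Summit.Langlands.Langlands.Theorems.FrobeniusUnitCarvingIntegrality

open scoped NumberField Polynomial MatrixGroups Matrix
open Filter IsDedekindDomain Field Polynomial NumberField
open Literature.NumberTheory.GaloisRepresentations Literature.NumberTheory.Automorphic Literature.NumberTheory.PAdicHodge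
open Summit.Langlands.Langlands.Theorems.FrobeniusUnitCarving (HasUnitFrobenius fu_of_langlands
  hasAlgebraicFrobenius_of_hasUnitFrobenius norm_multiset_prod_le_one)
open Summit.Langlands.Langlands.Theorems.FrobeniusAlgebraicityCarving (FrobeniusAlgebraicity HasAlgebraicFrobenius
  isAlgebraic_symm exists_eq_charpoly_of_hasFrobCharpolyAt)
open Summit.Langlands.Langlands.Theorems.FrobeniusUnitCarvingRankOne (hasUnitFrobenius_rankOne_of_namedFact)

/-! ## §1. Ultrametric pigeonhole on a multiset -/

section Multiset

variable {A : Type*} [NormedField A]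

/-- a product of norm-one elements has norm one. [folklore] -/
theorem norm_multiset_prod_eq_one (s : Multiset A) (h : ∀ x ∈ s, ‖x‖ = 1) : ‖s.prod‖ = 1 := by
  induction s using Multiset.induction_on with
  | empty => simp
  | cons a t ih =>
    rw [Multiset.prod_cons, norm_mul, h a (Multiset.mem_cons_self a t), one_mul]
    exact ih fun x hx => h x (Multiset.mem_cons_of_mem hx)

/-- **pigeonhole**: elements of norm `≤ 1` whose product has norm `1` all have norm `1`. [folklore] -/
theorem norm_eq_one_of_mem_of_norm_prod_eq_one (s : Multiset A) (hle : ∀ x ∈ s, ‖x‖ ≤ 1) (h1 : ‖s.prod‖ = 1)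
    {x : A} (hx : x ∈ s) : ‖x‖ = 1 := by
  obtain ⟨t, rfl⟩ := Multiset.exists_cons_of_mem hx
  rw [Multiset.prod_cons, norm_mul] at h1
  have hx1 : ‖x‖ ≤ 1 := hle x hx
  have ht1 : ‖t.prod‖ ≤ 1 := norm_multiset_prod_le_one t fun y hy => hle y (Multiset.mem_cons_of_mem hy)
  nlinarith [norm_nonneg x, norm_nonneg t.prod]

end Multiset

/-! ## §2. The constant coefficient of a Frobenius polynomial, transported to another avatar -/

section Local

variable {K : Type} [Field K] [NumberField K] {ℓ : ℕ} [Fact ℓ.Prime] {n : ℕ}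

/-- For a Frobenius polynomial `P` of `ρ` at `v` (so `P = charpoly ρ(σ)` for an arithmetic Frobenius `σ`, MONIC and SPLIT over `ℚ̄_ℓ`):
`P(0) = (−1)^{deg P} · ∏ roots`, hence for every avatar `ι'⁻¹ ∘ ι` the norm of `ι'⁻¹(ι P(0))` is the product of the norms of the
transported roots. [folklore] -/
theorem norm_symm_coeff_zero_eq_prod (ι : PadicAlgCl ℓ ≃+* ℂ) {ℓ' : ℕ} [Fact ℓ'.Prime] (ι' : PadicAlgCl ℓ' ≃+* ℂ)
    (ρ : FramedGaloisRep K (PadicAlgCl ℓ) n) {v : HeightOneSpectrum (𝓞 K)} {P : Polynomial (PadicAlgCl ℓ)}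
    (hP : ρ.HasFrobCharpolyAt v P) :
    ‖ι'.symm (ι (P.coeff 0))‖ = ‖(P.roots.map fun β => ι'.symm (ι β)).prod‖ := by
  obtain ⟨σ, -, hPσ⟩ := exists_eq_charpoly_of_hasFrobCharpolyAt ρ hP
  have hmonic : P.Monic := by rw [hPσ]; exact Matrix.charpoly_monic _
  have hsplit : P.Splits := IsAlgClosed.splits P
  have hc : P.coeff 0 = (-1) ^ P.natDegree * P.roots.prod := hsplit.coeff_zero_eq_prod_roots_of_monic hmonic
  let φ : PadicAlgCl ℓ →+* PadicAlgCl ℓ' := (ι'.symm : ℂ ≃+* PadicAlgCl ℓ').toRingHom.comp (ι : PadicAlgCl ℓ ≃+* ℂ).toRingHom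
  have hφ : ∀ x, φ x = ι'.symm (ι x) := fun x => rfl
  have hmap : (P.roots.map fun β => ι'.symm (ι β)) = P.roots.map φ := Multiset.map_congr rfl fun x _ => (hφ x).symm
  rw [← hφ, hc, map_mul, map_pow, map_neg, map_one, norm_mul, norm_pow, norm_neg, norm_one, one_pow, one_mul,
    map_multiset_prod, hmap]

/-- **INT ∧ DET ⟹ FU, per representation.**  If at almost every `v` the avatars of the Frobenius roots have norm `≤ 1` (INT) and the
avatar of the constant coefficient has norm `1` (DET), then the avatars of the roots have norm exactly `1`: `HasUnitFrobenius`.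
[folklore] -/
theorem hasUnitFrobenius_of_integral_of_det (ι : PadicAlgCl ℓ ≃+* ℂ) (ρ : FramedGaloisRep K (PadicAlgCl ℓ) n)
    (hI : ∀ᶠ v : HeightOneSpectrum (𝓞 K) in cofinite, ∀ P : Polynomial (PadicAlgCl ℓ), ρ.HasFrobCharpolyAt v P →
      ∀ β ∈ P.roots, ∀ (ℓ' : ℕ) [Fact ℓ'.Prime] (ι' : PadicAlgCl ℓ' ≃+* ℂ), ((ℓ' : ℕ) : 𝓞 K) ∉ v.asIdeal → ‖ι'.symm (ι β)‖ ≤ 1)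
    (hD : ∀ᶠ v : HeightOneSpectrum (𝓞 K) in cofinite, ∀ P : Polynomial (PadicAlgCl ℓ), ρ.HasFrobCharpolyAt v P →
      ∀ (ℓ' : ℕ) [Fact ℓ'.Prime] (ι' : PadicAlgCl ℓ' ≃+* ℂ), ((ℓ' : ℕ) : 𝓞 K) ∉ v.asIdeal → ‖ι'.symm (ι (P.coeff 0))‖ = 1) :
    HasUnitFrobenius K ℓ ι ρ := by
  filter_upwards [hI, hD] with v hIv hDv P hP β hβ ℓ' _ ι' hℓ'
  have hprod : ‖(P.roots.map fun β => ι'.symm (ι β)).prod‖ = 1 := by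
    rw [← norm_symm_coeff_zero_eq_prod ι ι' ρ hP]; exact hDv P hP ℓ' ι' hℓ'
  have hle : ∀ x ∈ (P.roots.map fun β => ι'.symm (ι β)), ‖x‖ ≤ 1 := by
    intro x hx
    obtain ⟨γ, hγ, rfl⟩ := Multiset.mem_map.1 hx
    exact hIv P hP γ hγ ℓ' ι' hℓ'
  exact norm_eq_one_of_mem_of_norm_prod_eq_one _ hle hprod (Multiset.mem_map_of_mem _ hβ)

omit [NumberField K] in
/-- FU ⟹ INT, per representation (`= ⇒ ≤`). [folklore] -/
theorem integral_of_hasUnitFrobenius (ι : PadicAlgCl ℓ ≃+* ℂ) (ρ : FramedGaloisRep K (PadicAlgCl ℓ) n)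
    (h : HasUnitFrobenius K ℓ ι ρ) :
    ∀ᶠ v : HeightOneSpectrum (𝓞 K) in cofinite, ∀ P : Polynomial (PadicAlgCl ℓ), ρ.HasFrobCharpolyAt v P →
      ∀ β ∈ P.roots, ∀ (ℓ' : ℕ) [Fact ℓ'.Prime] (ι' : PadicAlgCl ℓ' ≃+* ℂ), ((ℓ' : ℕ) : 𝓞 K) ∉ v.asIdeal → ‖ι'.symm (ι β)‖ ≤ 1 := by
  filter_upwards [h] with v hv P hP β hβ ℓ' _ ι' hℓ'
  exact (hv P hP β hβ ℓ' ι' hℓ').le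

/-- FU ⟹ DET, per representation: the constant coefficient is `±` a product of roots, all of whose avatars are units. [folklore] -/
theorem det_of_hasUnitFrobenius (ι : PadicAlgCl ℓ ≃+* ℂ) (ρ : FramedGaloisRep K (PadicAlgCl ℓ) n)
    (h : HasUnitFrobenius K ℓ ι ρ) :
    ∀ᶠ v : HeightOneSpectrum (𝓞 K) in cofinite, ∀ P : Polynomial (PadicAlgCl ℓ), ρ.HasFrobCharpolyAt v P →
      ∀ (ℓ' : ℕ) [Fact ℓ'.Prime] (ι' : PadicAlgCl ℓ' ≃+* ℂ), ((ℓ' : ℕ) : 𝓞 K) ∉ v.asIdeal → ‖ι'.symm (ι (P.coeff 0))‖ = 1 := by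
  filter_upwards [h] with v hv P hP ℓ' _ ι' hℓ'
  rw [norm_symm_coeff_zero_eq_prod ι ι' ρ hP]
  refine norm_multiset_prod_eq_one _ fun x hx => ?_
  obtain ⟨γ, hγ, rfl⟩ := Multiset.mem_map.1 hx
  exact hv P hP γ hγ ℓ' ι' hℓ'

/-- **per-representation EXACTNESS**: `HasUnitFrobenius ↔ INT ∧ DET`. [folklore] -/
theorem hasUnitFrobenius_iff_integral_and_det (ι : PadicAlgCl ℓ ≃+* ℂ) (ρ : FramedGaloisRep K (PadicAlgCl ℓ) n) :
    HasUnitFrobenius K ℓ ι ρ ↔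
      (∀ᶠ v : HeightOneSpectrum (𝓞 K) in cofinite, ∀ P : Polynomial (PadicAlgCl ℓ), ρ.HasFrobCharpolyAt v P →
        ∀ β ∈ P.roots, ∀ (ℓ' : ℕ) [Fact ℓ'.Prime] (ι' : PadicAlgCl ℓ' ≃+* ℂ), ((ℓ' : ℕ) : 𝓞 K) ∉ v.asIdeal → ‖ι'.symm (ι β)‖ ≤ 1) ∧
      (∀ᶠ v : HeightOneSpectrum (𝓞 K) in cofinite, ∀ P : Polynomial (PadicAlgCl ℓ), ρ.HasFrobCharpolyAt v P →
        ∀ (ℓ' : ℕ) [Fact ℓ'.Prime] (ι' : PadicAlgCl ℓ' ≃+* ℂ), ((ℓ' : ℕ) : 𝓞 K) ∉ v.asIdeal → ‖ι'.symm (ι (P.coeff 0))‖ = 1) :=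
  ⟨fun h => ⟨integral_of_hasUnitFrobenius ι ρ h, det_of_hasUnitFrobenius ι ρ h⟩,
    fun h => hasUnitFrobenius_of_integral_of_det ι ρ h.1 h.2⟩

omit [NumberField K] in
/-- **INT ⟹ algebraic Frobenius roots, per representation**: one-sided integrality of ALL avatars at the single prime `ℓ' ∈ {2,3}`
not under `v` already forces `ι β` (hence `β`) to be algebraic (Steinitz; tree `LArithmeticOfAutToGal.isAlgebraic_of_forall_norm_symm_le_one`).
[folklore] -/
theorem hasAlgebraicFrobenius_of_integral (ι : PadicAlgCl ℓ ≃+* ℂ) (ρ : FramedGaloisRep K (PadicAlgCl ℓ) n)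
    (hI : ∀ᶠ v : HeightOneSpectrum (𝓞 K) in cofinite, ∀ P : Polynomial (PadicAlgCl ℓ), ρ.HasFrobCharpolyAt v P →
      ∀ β ∈ P.roots, ∀ (ℓ' : ℕ) [Fact ℓ'.Prime] (ι' : PadicAlgCl ℓ' ≃+* ℂ), ((ℓ' : ℕ) : 𝓞 K) ∉ v.asIdeal → ‖ι'.symm (ι β)‖ ≤ 1) :
    HasAlgebraicFrobenius K ℓ ρ := by
  filter_upwards [hI] with v hv P hP β hβ
  have key : ∀ (ℓ' : ℕ) [Fact ℓ'.Prime], ((ℓ' : ℕ) : 𝓞 K) ∉ v.asIdeal → IsAlgebraic ℚ β := fun ℓ' _ hℓ' => by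
    have halg : IsAlgebraic ℚ (ι β) :=
      Summit.Langlands.Langlands.Theorems.LArithmeticOfAutToGal.isAlgebraic_of_forall_norm_symm_le_one ℓ'
        fun ι' => hv P hP β hβ ℓ' ι' hℓ'
    simpa using isAlgebraic_symm ι halg
  rcases Summit.Langlands.Langlands.Theorems.FrobeniusUnitCarving.two_not_mem_or_three_not_mem v with h2 | h3
  · haveI : Fact (Nat.Prime 2) := ⟨Nat.prime_two⟩
    exact key 2 h2
  · haveI : Fact (Nat.Prime 3) := ⟨Nat.prime_three⟩
    exact key 3 h3

end Local

/-! ## §3. Crux level: the ROUTE decl `Theses.FrobeniusUnitCarving.FrobeniusUnits` BY NAME -/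

/-- **FU ⟸ INT ∧ DET** (the route decl by name; INT and DET carry the FU binder prefix VERBATIM, conclusions `≤ 1` resp. `‖ι'⁻¹(ι P(0))‖ = 1`).
[folklore] -/
theorem frobeniusUnits_of_integrality_of_determinantUnits
    (hI : ∀ (K : Type) [Field K] [NumberField K] (n : ℕ), 0 < n → ∀ (ℓ : ℕ) [Fact ℓ.Prime] (ι : PadicAlgCl ℓ ≃+* ℂ) (ρ : Literature.NumberTheory.GaloisRepresentations.FramedGaloisRep K (PadicAlgCl ℓ) n), ρ.toGaloisRep.IsIrreducible → ((∀ᶠ v : IsDedekindDomain.HeightOneSpectrum (NumberField.RingOfIntegers K) in cofinite, ρ.IsUnramifiedAt v) ∧ ∀ (v : IsDedekindDomain.HeightOneSpectrum (NumberField.RingOfIntegers K)) (hv : ((ℓ : ℕ) : NumberField.RingOfIntegers K) ∈ v.asIdeal), (Literature.NumberTheory.PAdicHodge.fontainePstAdicCompletion v ℓ hv).IsDeRhamFramed (ρ.toLocal v)) → ∀ᶠ v : IsDedekindDomain.HeightOneSpectrum (NumberField.RingOfIntegers K) in Filter.cofinite, ∀ P : Polynomial (PadicAlgCl ℓ), ρ.HasFrobCharpolyAt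 v P → ∀ β ∈ P.roots, ∀ (ℓ' : ℕ) [Fact ℓ'.Prime] (ι' : PadicAlgCl ℓ' ≃+* ℂ), ((ℓ' : ℕ) : NumberField.RingOfIntegers K) ∉ v.asIdeal → ‖ι'.symm (ι β)‖ ≤ 1)
    (hD : ∀ (K : Type) [Field K] [NumberField K] (n : ℕ), 0 < n → ∀ (ℓ : ℕ) [Fact ℓ.Prime] (ι : PadicAlgCl ℓ ≃+* ℂ) (ρ : Literature.NumberTheory.GaloisRepresentations.FramedGaloisRep K (PadicAlgCl ℓ) n), ρ.toGaloisRep.IsIrreducible → ((∀ᶠ v : IsDedekindDomain.HeightOneSpectrum (NumberField.RingOfIntegers K) in cofinite, ρ.IsUnramifiedAt v) ∧ ∀ (v : IsDedekindDomain.HeightOneSpectrum (NumberField.RingOfIntegers K)) (hv : ((ℓ : ℕ) : NumberField.RingOfIntegers K) ∈ v.asIdeal), (Literature.NumberTheory.PAdicHodge.fontainePstAdicCompletion v ℓ hv).IsDeRhamFramed (ρ.toLocal v)) → ∀ᶠ v : IsDedekindDomain.HeightOneSpectrum (NumberField.RingOfIntegers K) in Filter.cofinite, ∀ P : Polynomial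 (PadicAlgCl ℓ), ρ.HasFrobCharpolyAt v P → ∀ (ℓ' : ℕ) [Fact ℓ'.Prime] (ι' : PadicAlgCl ℓ' ≃+* ℂ), ((ℓ' : ℕ) : NumberField.RingOfIntegers K) ∉ v.asIdeal → ‖ι'.symm (ι (P.coeff 0))‖ = 1) :
    Summit.Langlands.Langlands.Theses.FrobeniusUnitCarving.FrobeniusUnits := by
  intro K _ _ n hn ℓ _ ι ρ hirr hgeo
  exact hasUnitFrobenius_of_integral_of_det ι ρ (hI K n hn ℓ ι ρ hirr hgeo) (hD K n hn ℓ ι ρ hirr hgeo)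

/-- **FU ⟹ INT** (crux level, route decl by name). [folklore] -/
theorem integrality_of_frobeniusUnits (h : Summit.Langlands.Langlands.Theses.FrobeniusUnitCarving.FrobeniusUnits) :
    ∀ (K : Type) [Field K] [NumberField K] (n : ℕ), 0 < n → ∀ (ℓ : ℕ) [Fact ℓ.Prime] (ι : PadicAlgCl ℓ ≃+* ℂ) (ρ : Literature.NumberTheory.GaloisRepresentations.FramedGaloisRep K (PadicAlgCl ℓ) n), ρ.toGaloisRep.IsIrreducible → ((∀ᶠ v : IsDedekindDomain.HeightOneSpectrum (NumberField.RingOfIntegers K) in cofinite, ρ.IsUnramifiedAt v) ∧ ∀ (v : IsDedekindDomain.HeightOneSpectrum (NumberField.RingOfIntegers K)) (hv : ((ℓ : ℕ) : NumberField.RingOfIntegers K) ∈ v.asIdeal), (Literature.NumberTheory.PAdicHodge.fontainePstAdicCompletion v ℓ hv).IsDeRhamFramed (ρ.toLocal v)) → ∀ᶠ v : IsDedekindDomain.HeightOneSpectrum (NumberField.RingOfIntegers K) in Filter.cofinite, ∀ P : Polynomial (PadicAlgCl ℓ), ρ.HasFrobCharpolyAt v P → ∀ β ∈ P.roots, ∀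 (ℓ' : ℕ) [Fact ℓ'.Prime] (ι' : PadicAlgCl ℓ' ≃+* ℂ), ((ℓ' : ℕ) : NumberField.RingOfIntegers K) ∉ v.asIdeal → ‖ι'.symm (ι β)‖ ≤ 1 :=
  fun K _ _ n hn ℓ _ ι ρ hirr hgeo => integral_of_hasUnitFrobenius ι ρ (h K n hn ℓ ι ρ hirr hgeo)

/-- **FU ⟹ DET** (crux level, route decl by name). [folklore] -/
theorem determinantUnits_of_frobeniusUnits (h : Summit.Langlands.Langlands.Theses.FrobeniusUnitCarving.FrobeniusUnits) :
    ∀ (K : Type) [Field K] [NumberField K] (n : ℕ), 0 < n → ∀ (ℓ : ℕ) [Fact ℓ.Prime] (ι : PadicAlgCl ℓ ≃+* ℂ) (ρ : Literature.NumberTheory.GaloisRepresentations.FramedGaloisRep K (PadicAlgCl ℓ) n), ρ.toGaloisRep.IsIrreducible → ((∀ᶠ v : IsDedekindDomain.HeightOneSpectrum (NumberField.RingOfIntegers K) in cofinite, ρ.IsUnramifiedAt v) ∧ ∀ (v : IsDedekindDomain.HeightOneSpectrum (NumberField.RingOfIntegers K)) (hv : ((ℓ : ℕ) : NumberField.RingOfIntegers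 K) ∈ v.asIdeal), (Literature.NumberTheory.PAdicHodge.fontainePstAdicCompletion v ℓ hv).IsDeRhamFramed (ρ.toLocal v)) → ∀ᶠ v : IsDedekindDomain.HeightOneSpectrum (NumberField.RingOfIntegers K) in Filter.cofinite, ∀ P : Polynomial (PadicAlgCl ℓ), ρ.HasFrobCharpolyAt v P → ∀ (ℓ' : ℕ) [Fact ℓ'.Prime] (ι' : PadicAlgCl ℓ' ≃+* ℂ), ((ℓ' : ℕ) : NumberField.RingOfIntegers K) ∉ v.asIdeal → ‖ι'.symm (ι (P.coeff 0))‖ = 1 :=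
  fun K _ _ n hn ℓ _ ι ρ hirr hgeo => det_of_hasUnitFrobenius ι ρ (h K n hn ℓ ι ρ hirr hgeo)

/-- **INT ⟹ FA** (g32's crux `Theorems.FrobeniusAlgebraicityCarving.FrobeniusAlgebraicity`, BY NAME): FA is `ι`-free, so pick any avatar
(`PadicAlgCl.nonempty_ringEquiv_complex`) and descend one-sided integrality at `ℓ' ∈ {2, 3}` to algebraicity. [folklore] -/
theorem frobeniusAlgebraicity_of_integrality
    (hI : ∀ (K : Type) [Field K] [NumberField K] (n : ℕ), 0 < n → ∀ (ℓ : ℕ) [Fact ℓ.Prime] (ι : PadicAlgCl ℓ ≃+* ℂ) (ρ : Literature.NumberTheory.GaloisRepresentations.FramedGaloisRep K (PadicAlgCl ℓ) n), ρ.toGaloisRep.IsIrreducible → ((∀ᶠ v : IsDedekindDomain.HeightOneSpectrum (NumberField.RingOfIntegers K) in cofinite, ρ.IsUnramifiedAt v) ∧ ∀ (v : IsDedekindDomain.HeightOneSpectrum (NumberField.RingOfIntegers K)) (hv : ((ℓ : ℕ) : NumberField.RingOfIntegers K) ∈ v.asIdeal), (Literature.NumberTheory.PAdicHodge.fontainePstAdicCompletion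 v ℓ hv).IsDeRhamFramed (ρ.toLocal v)) → ∀ᶠ v : IsDedekindDomain.HeightOneSpectrum (NumberField.RingOfIntegers K) in Filter.cofinite, ∀ P : Polynomial (PadicAlgCl ℓ), ρ.HasFrobCharpolyAt v P → ∀ β ∈ P.roots, ∀ (ℓ' : ℕ) [Fact ℓ'.Prime] (ι' : PadicAlgCl ℓ' ≃+* ℂ), ((ℓ' : ℕ) : NumberField.RingOfIntegers K) ∉ v.asIdeal → ‖ι'.symm (ι β)‖ ≤ 1) :
    FrobeniusAlgebraicity := by
  intro K _ _ n hn ℓ _ ρ hirr hgeo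
  obtain ⟨ι⟩ := PadicAlgCl.nonempty_ringEquiv_complex ℓ
  exact hasAlgebraicFrobenius_of_integral ι ρ (hI K n hn ℓ ι ρ hirr hgeo)

/-- **EXACTNESS at crux level**: `FU ↔ INT ∧ DET` (route decl by name). [folklore] -/
theorem frobeniusUnits_iff_integrality_and_determinantUnits :
    Summit.Langlands.Langlands.Theses.FrobeniusUnitCarving.FrobeniusUnits ↔
      ((∀ (K : Type) [Field K] [NumberField K] (n : ℕ), 0 < n → ∀ (ℓ : ℕ) [Fact ℓ.Prime] (ι : PadicAlgCl ℓ ≃+* ℂ) (ρ : Literature.NumberTheory.GaloisRepresentations.FramedGaloisRep K (PadicAlgCl ℓ) n), ρ.toGaloisRep.IsIrreducible → ((∀ᶠ v : IsDedekindDomain.HeightOneSpectrum (NumberField.RingOfIntegers K) in cofinite, ρ.IsUnramifiedAt v) ∧ ∀ (v : IsDedekindDomain.HeightOneSpectrum (NumberField.RingOfIntegers K)) (hv : ((ℓ : ℕ) : NumberField.RingOfIntegers K) ∈ v.asIdeal), (Literature.NumberTheory.PAdicHodge.fontainePstAdicCompletion v ℓ hv).IsDeRhamFramed (ρ.toLocal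 v)) → ∀ᶠ v : IsDedekindDomain.HeightOneSpectrum (NumberField.RingOfIntegers K) in Filter.cofinite, ∀ P : Polynomial (PadicAlgCl ℓ), ρ.HasFrobCharpolyAt v P → ∀ β ∈ P.roots, ∀ (ℓ' : ℕ) [Fact ℓ'.Prime] (ι' : PadicAlgCl ℓ' ≃+* ℂ), ((ℓ' : ℕ) : NumberField.RingOfIntegers K) ∉ v.asIdeal → ‖ι'.symm (ι β)‖ ≤ 1) ∧
       (∀ (K : Type) [Field K] [NumberField K] (n : ℕ), 0 < n → ∀ (ℓ : ℕ) [Fact ℓ.Prime] (ι : PadicAlgCl ℓ ≃+* ℂ) (ρ : Literature.NumberTheory.GaloisRepresentations.FramedGaloisRep K (PadicAlgCl ℓ) n), ρ.toGaloisRep.IsIrreducible → ((∀ᶠ v : IsDedekindDomain.HeightOneSpectrum (NumberField.RingOfIntegers K) in cofinite, ρ.IsUnramifiedAt v) ∧ ∀ (v : IsDedekindDomain.HeightOneSpectrum (NumberField.RingOfIntegers K)) (hv : ((ℓ : ℕ) : NumberField.RingOfIntegers K) ∈ v.asIdeal), (Literature.NumberTheory.PAdicHodge.fontainePstAdicCompletion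 v ℓ hv).IsDeRhamFramed (ρ.toLocal v)) → ∀ᶠ v : IsDedekindDomain.HeightOneSpectrum (NumberField.RingOfIntegers K) in Filter.cofinite, ∀ P : Polynomial (PadicAlgCl ℓ), ρ.HasFrobCharpolyAt v P → ∀ (ℓ' : ℕ) [Fact ℓ'.Prime] (ι' : PadicAlgCl ℓ' ≃+* ℂ), ((ℓ' : ℕ) : NumberField.RingOfIntegers K) ∉ v.asIdeal → ‖ι'.symm (ι (P.coeff 0))‖ = 1)) :=
  ⟨fun h => ⟨integrality_of_frobeniusUnits h, determinantUnits_of_frobeniusUnits h⟩,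
    fun h => frobeniusUnits_of_integrality_of_determinantUnits h.1 h.2⟩

/-! ## §4. Necessity: both pieces are S-implied (through the landed `fu_of_langlands`) -/

/-- the landed twin text `Theorems.FrobeniusUnitCarving.FrobeniusUnits` IS the route decl (syntactically identical bodies). [folklore] -/
theorem frobeniusUnits_route_iff_twin :
    Summit.Langlands.Langlands.Theses.FrobeniusUnitCarving.FrobeniusUnits ↔
      Summit.Langlands.Langlands.Theorems.FrobeniusUnitCarving.FrobeniusUnits :=
  Iff.rfl

/-- **INT is S-implied** (kernel, mod nothing): `Langlands → INT`. [folklore] -/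
theorem integrality_of_langlands (hL : _root_.Langlands) :
    ∀ (K : Type) [Field K] [NumberField K] (n : ℕ), 0 < n → ∀ (ℓ : ℕ) [Fact ℓ.Prime] (ι : PadicAlgCl ℓ ≃+* ℂ) (ρ : Literature.NumberTheory.GaloisRepresentations.FramedGaloisRep K (PadicAlgCl ℓ) n), ρ.toGaloisRep.IsIrreducible → ((∀ᶠ v : IsDedekindDomain.HeightOneSpectrum (NumberField.RingOfIntegers K) in cofinite, ρ.IsUnramifiedAt v) ∧ ∀ (v : IsDedekindDomain.HeightOneSpectrum (NumberField.RingOfIntegers K)) (hv : ((ℓ : ℕ) : NumberField.RingOfIntegers K) ∈ v.asIdeal), (Literature.NumberTheory.PAdicHodge.fontainePstAdicCompletion v ℓ hv).IsDeRhamFramed (ρ.toLocal v)) → ∀ᶠ v : IsDedekindDomain.HeightOneSpectrum (NumberField.RingOfIntegers K) in Filter.cofinite, ∀ P : Polynomial (PadicAlgCl ℓ), ρ.HasFrobCharpolyAt v P → ∀ β ∈ P.roots, ∀ (ℓ' : ℕ) [Fact ℓ'.Prime] (ι' : PadicAlgCl ℓ' ≃+* ℂ), ((ℓ' : ℕ)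 : NumberField.RingOfIntegers K) ∉ v.asIdeal → ‖ι'.symm (ι β)‖ ≤ 1 :=
  integrality_of_frobeniusUnits (frobeniusUnits_route_iff_twin.2 (fu_of_langlands hL))

/-- **DET is S-implied** (kernel, mod nothing): `Langlands → DET`. [folklore] -/
theorem determinantUnits_of_langlands (hL : _root_.Langlands) :
    ∀ (K : Type) [Field K] [NumberField K] (n : ℕ), 0 < n → ∀ (ℓ : ℕ) [Fact ℓ.Prime] (ι : PadicAlgCl ℓ ≃+* ℂ) (ρ : Literature.NumberTheory.GaloisRepresentations.FramedGaloisRep K (PadicAlgCl ℓ) n), ρ.toGaloisRep.IsIrreducible → ((∀ᶠ v : IsDedekindDomain.HeightOneSpectrum (NumberField.RingOfIntegers K) in cofinite, ρ.IsUnramifiedAt v) ∧ ∀ (v : IsDedekindDomain.HeightOneSpectrum (NumberField.RingOfIntegers K)) (hv : ((ℓ : ℕ) : NumberField.RingOfIntegers K) ∈ v.asIdeal), (Literature.NumberTheory.PAdicHodge.fontainePstAdicCompletion v ℓ hv).IsDeRhamFramed (ρ.toLocal v)) → ∀ᶠ v : IsDedekindDomain.HeightOneSpectrum (NumberField.RingOfIntegers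 K) in Filter.cofinite, ∀ P : Polynomial (PadicAlgCl ℓ), ρ.HasFrobCharpolyAt v P → ∀ (ℓ' : ℕ) [Fact ℓ'.Prime] (ι' : PadicAlgCl ℓ' ≃+* ℂ), ((ℓ' : ℕ) : NumberField.RingOfIntegers K) ∉ v.asIdeal → ‖ι'.symm (ι (P.coeff 0))‖ = 1 :=
  determinantUnits_of_frobeniusUnits (frobeniusUnits_route_iff_twin.2 (fu_of_langlands hL))


/-! ## §5. DET from the named Hecke-dictionary fact and «de Rham ⇒ det de Rham» (the PRINT status of DET, typed) -/

section Determinant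

variable {K : Type} [Field K] [NumberField K] {ℓ : ℕ} [Fact ℓ.Prime] {n : ℕ}

omit [NumberField K] in
/-- the rank-one framed representation `det ρ : Γ_K → GL₁(ℚ̄_ℓ)` has, at an arithmetic Frobenius `τ`, characteristic polynomial
`X − det ρ(τ)`. [folklore] -/
theorem charpoly_detFramed_apply (ρ : FramedGaloisRep K (PadicAlgCl ℓ) n) (τ : absoluteGaloisGroup K) :
    FramedRep.charpoly ((FramedRep.unitsContinuousMulEquivOfUnique (Fin 1) (PadicAlgCl ℓ) : (PadicAlgCl ℓ)ˣ →ₜ* GL (Fin 1) (PadicAlgCl ℓ)).comp (FramedRep.det ρ)) τ =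
      X - C (((ρ τ : GL (Fin n) (PadicAlgCl ℓ)) : Matrix (Fin n) (Fin n) (PadicAlgCl ℓ)).det) := by
  unfold FramedRep.charpoly
  rw [Matrix.charpoly, Matrix.det_fin_one, Matrix.charmatrix_apply_eq]
  rfl

omit [NumberField K] in
/-- for a Frobenius polynomial `P` of `ρ` at `v`, every arithmetic Frobenius `τ` at `v` has `det ρ(τ) = (−1)ⁿ P(0)`; hence
`X − C((−1)ⁿ P(0))` is a Frobenius polynomial of `det ρ` at `v` (no unramifiedness needed). [folklore] -/
theorem hasFrobCharpolyAt_detFramed (ρ : FramedGaloisRep K (PadicAlgCl ℓ) n) {v : HeightOneSpectrum (𝓞 K)}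
    {P : Polynomial (PadicAlgCl ℓ)} (hP : ρ.HasFrobCharpolyAt v P) :
    FramedGaloisRep.HasFrobCharpolyAt v (X - C ((-1) ^ n * P.coeff 0)) ((FramedRep.unitsContinuousMulEquivOfUnique (Fin 1) (PadicAlgCl ℓ) : (PadicAlgCl ℓ)ˣ →ₜ* GL (Fin 1) (PadicAlgCl ℓ)).comp (FramedRep.det ρ)) := by
  intro 𝔓 h𝔓 τ hτ
  rw [charpoly_detFramed_apply]
  congr 2
  have hPτ : FramedRep.charpoly ρ τ = P := hP 𝔓 h𝔓 τ hτ
  have hdet := Matrix.det_eq_sign_charpoly_coeff ((ρ τ : GL (Fin n) (PadicAlgCl ℓ)) : Matrix (Fin n) (Fin n) (PadicAlgCl ℓ))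
  rw [Fintype.card_fin] at hdet
  rw [hdet, ← hPτ]
  rfl

/-- **DET per representation ⟸ the Hecke dictionary (named fact) + de Rham-ness of `det ρ` above `ℓ`**: if `det ρ` (as a rank-one framed
representation) is de Rham at the places above `ℓ`, the named fact `FramedGaloisRep.exists_heckeCharacter_of_isDeRhamFramed` makes it the avatar
of an algebraic Hecke character, whose Frobenius values are `ℓ'`-adic units away from `p_v` (Weil; landed `hasUnitFrobenius_rankOne_of_namedFact`),
and `det ρ(Frob_v) = (−1)ⁿ P(0)`. [cite: SerreAbelianLadic1968, Ch. III §2.3 Thm. 2] -/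
theorem det_of_namedFact_of_detDeRham (h : FramedGaloisRep.exists_heckeCharacter_of_isDeRhamFramed) (ι : PadicAlgCl ℓ ≃+* ℂ)
    (ρ : FramedGaloisRep K (PadicAlgCl ℓ) n)
    (hdR : ∀ (v : HeightOneSpectrum (𝓞 K)) (hv : ((ℓ : ℕ) : 𝓞 K) ∈ v.asIdeal),
      (fontainePstAdicCompletion v ℓ hv).IsDeRhamFramed (FramedGaloisRep.toLocal v ((FramedRep.unitsContinuousMulEquivOfUnique (Fin 1) (PadicAlgCl ℓ) : (PadicAlgCl ℓ)ˣ →ₜ* GL (Fin 1) (PadicAlgCl ℓ)).comp (FramedRep.det ρ)))) :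
    ∀ᶠ v : HeightOneSpectrum (𝓞 K) in cofinite, ∀ P : Polynomial (PadicAlgCl ℓ), ρ.HasFrobCharpolyAt v P →
      ∀ (ℓ' : ℕ) [Fact ℓ'.Prime] (ι' : PadicAlgCl ℓ' ≃+* ℂ), ((ℓ' : ℕ) : 𝓞 K) ∉ v.asIdeal → ‖ι'.symm (ι (P.coeff 0))‖ = 1 := by
  have hU : HasUnitFrobenius K ℓ ι ((FramedRep.unitsContinuousMulEquivOfUnique (Fin 1) (PadicAlgCl ℓ) : (PadicAlgCl ℓ)ˣ →ₜ* GL (Fin 1) (PadicAlgCl ℓ)).comp (FramedRep.det ρ)) := hasUnitFrobenius_rankOne_of_namedFact h ι _ hdR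
  filter_upwards [hU] with v hv P hP ℓ' _ ι' hℓ'
  have hroot : (-1) ^ n * P.coeff 0 ∈ (X - C ((-1) ^ n * P.coeff 0) : Polynomial (PadicAlgCl ℓ)).roots := by
    rw [roots_X_sub_C]; exact Multiset.mem_singleton_self _
  have h1 : ‖ι'.symm (ι ((-1) ^ n * P.coeff 0))‖ = 1 := hv _ (hasFrobCharpolyAt_detFramed ρ hP) _ hroot ℓ' ι' hℓ'
  rwa [map_mul, map_pow, map_neg, map_one, map_mul, map_pow, map_neg, map_one, norm_mul, norm_pow, norm_neg, norm_one, one_pow,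
    one_mul] at h1

end Determinant

/-- **DET ⟸ named fact + «de Rham ⇒ det de Rham»** (crux level; both hypotheses are PRINT: Serre III §2.3 Thm. 2 / Patrikis 2019 Prop. 2.2.1, and
Fontaine's ⊗-stability of de Rham representations, Exp. III Prop. 1.5.2 — the latter is NOT yet in the tree for `Λⁿ`, only for twists by rank-one
characters (`PstWeilDeligneData.IsDeRhamFramed.twist_det`), so it is carried as the hypothesis `hdet`). [cite: SerreAbelianLadic1968, Ch. III §2.3 Thm. 2] -/
theorem determinantUnits_of_namedFact_of_detDeRham (h : FramedGaloisRep.exists_heckeCharacter_of_isDeRhamFramed)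
    (hdet : ∀ (K : Type) [Field K] [NumberField K] (n : ℕ) (ℓ : ℕ) [Fact ℓ.Prime]
      (ρ : Literature.NumberTheory.GaloisRepresentations.FramedGaloisRep K (PadicAlgCl ℓ) n),
      (∀ (v : IsDedekindDomain.HeightOneSpectrum (NumberField.RingOfIntegers K)) (hv : ((ℓ : ℕ) : NumberField.RingOfIntegers K) ∈ v.asIdeal),
        (Literature.NumberTheory.PAdicHodge.fontainePstAdicCompletion v ℓ hv).IsDeRhamFramed (ρ.toLocal v)) →
      ∀ (v : IsDedekindDomain.HeightOneSpectrum (NumberField.RingOfIntegers K)) (hv : ((ℓ : ℕ) : NumberField.RingOfIntegers K) ∈ v.asIdeal),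
        (Literature.NumberTheory.PAdicHodge.fontainePstAdicCompletion v ℓ hv).IsDeRhamFramed
          (FramedGaloisRep.toLocal v ((FramedRep.unitsContinuousMulEquivOfUnique (Fin 1) (PadicAlgCl ℓ) : (PadicAlgCl ℓ)ˣ →ₜ* GL (Fin 1) (PadicAlgCl ℓ)).comp (FramedRep.det ρ)))) :
    ∀ (K : Type) [Field K] [NumberField K] (n : ℕ), 0 < n → ∀ (ℓ : ℕ) [Fact ℓ.Prime] (ι : PadicAlgCl ℓ ≃+* ℂ) (ρ : Literature.NumberTheory.GaloisRepresentations.FramedGaloisRep K (PadicAlgCl ℓ) n), ρ.toGaloisRep.IsIrreducible → ((∀ᶠ v : IsDedekindDomain.HeightOneSpectrum (NumberField.RingOfIntegers K) in cofinite, ρ.IsUnramifiedAt v) ∧ ∀ (v : IsDedekindDomain.HeightOneSpectrum (NumberField.RingOfIntegers K)) (hv : ((ℓ : ℕ) : NumberField.RingOfIntegers K) ∈ v.asIdeal), (Literature.NumberTheory.PAdicHodge.fontainePstAdicCompletion v ℓ hv).IsDeRhamFramed (ρ.toLocal v)) → ∀ᶠ v : IsDedekindDomain.HeightOneSpectrum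 (NumberField.RingOfIntegers K) in Filter.cofinite, ∀ P : Polynomial (PadicAlgCl ℓ), ρ.HasFrobCharpolyAt v P → ∀ (ℓ' : ℕ) [Fact ℓ'.Prime] (ι' : PadicAlgCl ℓ' ≃+* ℂ), ((ℓ' : ℕ) : NumberField.RingOfIntegers K) ∉ v.asIdeal → ‖ι'.symm (ι (P.coeff 0))‖ = 1 := by
  intro K _ _ n hn ℓ _ ι ρ hirr hgeo
  exact det_of_namedFact_of_detDeRham h ι ρ (hdet K n ℓ ρ hgeo.2)

/-- **PUNCHLINE — modulo class field theory, FU is ONE-SIDED INTEGRALITY**: granted the named Hecke-dictionary fact and «de Rham ⇒ det de Rham»,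
`FU ↔ INT`. [cite: SerreAbelianLadic1968, Ch. III §2.3 Thm. 2] -/
theorem frobeniusUnits_iff_integrality_of_namedFact_of_detDeRham (h : FramedGaloisRep.exists_heckeCharacter_of_isDeRhamFramed)
    (hdet : ∀ (K : Type) [Field K] [NumberField K] (n : ℕ) (ℓ : ℕ) [Fact ℓ.Prime]
      (ρ : Literature.NumberTheory.GaloisRepresentations.FramedGaloisRep K (PadicAlgCl ℓ) n),
      (∀ (v : IsDedekindDomain.HeightOneSpectrum (NumberField.RingOfIntegers K)) (hv : ((ℓ : ℕ) : NumberField.RingOfIntegers K) ∈ v.asIdeal),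
        (Literature.NumberTheory.PAdicHodge.fontainePstAdicCompletion v ℓ hv).IsDeRhamFramed (ρ.toLocal v)) →
      ∀ (v : IsDedekindDomain.HeightOneSpectrum (NumberField.RingOfIntegers K)) (hv : ((ℓ : ℕ) : NumberField.RingOfIntegers K) ∈ v.asIdeal),
        (Literature.NumberTheory.PAdicHodge.fontainePstAdicCompletion v ℓ hv).IsDeRhamFramed
          (FramedGaloisRep.toLocal v ((FramedRep.unitsContinuousMulEquivOfUnique (Fin 1) (PadicAlgCl ℓ) : (PadicAlgCl ℓ)ˣ →ₜ* GL (Fin 1) (PadicAlgCl ℓ)).comp (FramedRep.det ρ)))) :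
    Summit.Langlands.Langlands.Theses.FrobeniusUnitCarving.FrobeniusUnits ↔ (∀ (K : Type) [Field K] [NumberField K] (n : ℕ), 0 < n → ∀ (ℓ : ℕ) [Fact ℓ.Prime] (ι : PadicAlgCl ℓ ≃+* ℂ) (ρ : Literature.NumberTheory.GaloisRepresentations.FramedGaloisRep K (PadicAlgCl ℓ) n), ρ.toGaloisRep.IsIrreducible → ((∀ᶠ v : IsDedekindDomain.HeightOneSpectrum (NumberField.RingOfIntegers K) in cofinite, ρ.IsUnramifiedAt v) ∧ ∀ (v : IsDedekindDomain.HeightOneSpectrum (NumberField.RingOfIntegers K)) (hv : ((ℓ : ℕ) : NumberField.RingOfIntegers K) ∈ v.asIdeal), (Literature.NumberTheory.PAdicHodge.fontainePstAdicCompletion v ℓ hv).IsDeRhamFramed (ρ.toLocal v)) → ∀ᶠ v : IsDedekindDomain.HeightOneSpectrum (NumberField.RingOfIntegers K) in Filter.cofinite, ∀ P : Polynomial (PadicAlgCl ℓ), ρ.HasFrobCharpolyAt v P → ∀ β ∈ P.roots, ∀ (ℓ' : ℕ) [Fact ℓ'.Prime] (ι' : PadicAlgCl ℓ' ≃+* ℂ),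 ((ℓ' : ℕ) : NumberField.RingOfIntegers K) ∉ v.asIdeal → ‖ι'.symm (ι β)‖ ≤ 1) :=
  ⟨integrality_of_frobeniusUnits, fun hI =>
    frobeniusUnits_of_integrality_of_determinantUnits hI (determinantUnits_of_namedFact_of_detDeRham h hdet)⟩

end Summit.Langlands.Langlands.Theorems.FrobeniusUnitCarvingIntegrality
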